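import Summits.Ventures.PercRepro.RankLevelSetLevelSixHeavyCellSq27DI2V
import Summits.Ventures.PercRepro.RankLevelSetCoreSixColoopFreeUnion
import Summits.Ventures.PercRepro.RankLevelSetLevelSixCapGlue25
import Summits.Ventures.PercRepro.TriangleCapEightI
import Summits.Ventures.PercRepro.S1TrianglePlusSharp
import Summits.Ventures.PercRepro.S1SeriesLever14
import Summits.Ventures.PercRepro.RankLevelSetCircuitUnionRank
import Summits.Ventures.PercRepro.RankLevelSetDepCountHeavyB
import Summits.Ventures.PercRepro.RankLevelSetFourCircuitNullityFourSharp
import Summits.Ventures.PercRepro.RankLevelSetFiveCircuitNullityFourSharp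
import Summits.Ventures.PercRepro.S2CoreSeventeenSplit
import Summits.Ventures.PercRepro.RankLevelSetCoreSixColoopFree
import Summits.Ventures.PercRepro.RankLevelSetLevelSixHeavyCellSq27DI2VTwoTri
import Summits.Ventures.PercRepro.RankLevelSetLevelSixArithTwoTriSq22F7

/-!
# PercRepro — THE COLOOP-FREE CELL `(22, 7)` WITH TWO DISTINCT TRIANGLES (p8 g12, S3)

`proofs/P8-G12-LEVER22.md` §2: the branch `s₃ ≥ 2` of the cell `(22, 7)` — the two-triangle cell
`c025_core_six_heavy_cell_sq27di2v_twotri` at `(22, 7, ν₁ = 7, uG = uH = 0, b = 0, Kn / Kd = 10000 / 200, a = 13)` with the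
caps `c₃ = 10` (THE TRIANGLE DROP at `2·7 < 22`), `c₄ = 42` (`gb14 7 29`), `c₅ = 253`, `c₆ = 582`, `c₇ = 1044` (the
coloop-free averaging steps at `n = 29`), the `6`-set term `C(29, 6) − C(23, 6)`; ratio `0.947`. The branches `s₃ ≤ 1`
(with `c₃ = 1`, and `c₄ = 1` when `s₄ ≤ 1`) are the existing cell `sq27di2v` with those caps and their own arithmetic (not in
this module). Axioms: standard.
-/

open scoped Matroid

namespace PercRepro

namespace ThmN

open Set

variable {α : Type}

set_option maxHeartbeats 1600000 in
/-- **THE COLOOP-FREE CELL `(22, 7)` WITH TWO DISTINCT TRIANGLES** (level 0, `phiK 22 6`, `D = C(28, 6)`). -/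
theorem c025_core_six_t22_free7_twotri (M : Matroid α) [M.Finite] (hcf : ∀ e ∈ M.E, ¬ M.IsColoop e)
    (hR : M.eRank = (22 : ℕ∞)) (hn : M.E.ncard = 22 + 7)
    (hfree : ∀ e ∈ M.E, ∃ A ⊆ M.E \ {e}, e ∉ M.closure A ∧ e ∉ M.closure ((M.E \ {e}) \ A))
    (htwo : ∃ C₁ C₂ : Set α, M.IsCircuit C₁ ∧ M.IsCircuit C₂ ∧ C₁.ncard = 3 ∧ C₂.ncard = 3 ∧ C₁ ≠ C₂) :
    RLS M 22 6 := by
  classical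
  have hR' : M.eRank = ((22 : ℕ) : ℕ∞) := hR
  have hd : M.E.encard = M.eRank + (7 : ℕ) := by
    rw [hR, ← M.ground_finite.cast_ncard_eq, hn]
    push_cast
    ring
  have hflat6 : ∀ X ⊆ M.E, M.eRk X ≤ ((6 : ℕ) : ℕ∞) → X.ncard ≤ 12 :=
    fun X hX hr => ncard_le_five_add_of_coloopFree M hcf hR' hn (by omega) hX (by exact_mod_cast hr)
  have hflat5 : ∀ X ⊆ M.E, M.eRk X ≤ ((6 - 1 : ℕ) : ℕ∞) → X.ncard ≤ 11 :=
    fun X hX hr => ncard_le_four_add_of_coloopFree M hcf hR' hn (by omega) hX hr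
  have hUG : (Matroid.UG M 6 7).ncard ≤ 0 := by
    rw [UG_eq_empty_of_cap M hflat6 (by norm_num)]; simp
  have hUH : (Matroid.UH M 6 7).ncard ≤ 0 := by
    rw [Matroid.UH_eq_empty (M := M) (q := 6) (ν₁ := 7) hflat5 (by norm_num)]; simp
  have hΦ : phiK 22 6 ≤ (2 : ℚ) ^ (22 + 6) / (((22 + 6).choose 6 : ℕ) : ℚ) := phiK_le_two_pow_div_six 22
  rw [RLS_iff]
  exact c025_core_six_heavy_cell_sq27di2v_twotri M 22 7 7 0 0 0 10000 200 13 253 42 10 582 1044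
      ((22 + 6).choose 6) (Nat.choose_pos (by omega)) (phiK 22 6) hΦ (by norm_num) (by omega)
      (by norm_num) hUG hUH (by omega) (Or.inl (by norm_num)) (by norm_num) (by norm_num) (by norm_num)
      ((ncard_triangles_le_cq3_pred_of_coloopFree M hfree hcf hR' hn (by omega) (by omega) (by omega)).trans (by decide))
      ((S1.ncard_fourCircuits_le_gb14 7 M hfree hd 29 (by rw [coloops_eq_empty_of_forall M hcf, Set.sdiff_empty, hn])).trans (by decide))
      (s5_cf_of M hfree hcf (d := 6) (by rw [hd]; norm_num) 29 210 253 (by norm_num) (by omega) (by decide) (by omega))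
      (s6_cf_of M hfree hcf (d := 6) (by rw [hd]; norm_num) 29 462 582 (by norm_num) (by omega) (by decide) (by omega))
      (s7_cf_of M hfree hcf (d := 6) (by rw [hd]; norm_num) 29 792 1044 (by norm_num) (by omega) (by decide) (by omega))
      (Or.inl tail_six_twotri_sq22F7) hR' hn hfree (by omega) htwo level_six_poly_twotri_sq22F7

end ThmN

end PercRepro
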